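import Summits.QuantumFields.YangMills.Theorems.BalabanUVNodesSpineRates
import Summits.QuantumFields.YangMills.Theorems.BalabanUVNodesN18KingModelTorus
import Summits.QuantumFields.YangMills.Theorems.BalabanUVNodesN18DressedCarriers
import Summits.QuantumFields.YangMills.Theorems.BalabanUVNodesN18End

/-!
# BalabanUVNodes ∕ N18 — the node's STATEMENT OF RECORD in the ROUTE's vocabulary, `YMDAG.UVSplit.N18At` (module 2
# `BalabanUVNodesSpineRates`, p418381), read, transported and INHABITED BY NAME; the shape of the `S_N18 RRec` one-liner
# (Track A, DAG node N18 = NE5 `T4OutputRate.NE5 EA EB W κ θ C₅` :211 ↦ cluster K4 stub `S_N18 RRec := ∀ …, RRec … R → N18At R.u3`)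

HONEST FRAMING.  Count-neutral kernel bookkeeping (seat pub-ymgap-dag-n18-a g4, KNIT-BY-NAME; `--supports stmt-QuantumFields-19182`).
Nothing of Bałaban's one-step outputs `E^{(j)}(X; g, U)` is asserted or discharged: NE5 is NOT IN PRINT ([Balaban1987RG1] Thm 1
p. 259 has only the uniformity in ε) and has no tree producer at the carriers of record (NODE O 0∕1; NODE 00's rate-record
predicate `RRec` not yet typed); the model inhabitant is King's A = 0 scalar MODEL; NOT a node discharge; one finite torus;
nothing continuum ∕ ℝ⁴ ∕ OS ∕ mass-gap ∕ Clay.  THEOREMS ONLY: 0 `def`, 0 `sorry`, standard axioms.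

THE POINT.  Since module 2 of the route package landed, N18's statement of record is the tree constant
`YMDAG.UVSplit.N18At (u : U3Carriers) : Prop := ∀ b : ℝ, 0 < b → b ≤ u.γ → NE5 u.EA (u.EB b) u.W u.κ u.θ u.C₅` on node U3's
SHARED carrier bundle `U3Carriers = ⟨C, W, γ, κ, EA, EB, θ, C₅, Λ, C₉, ω, cr, ρ⟩`, and the K4 stub is
`S_N18 RRec := ∀ F D g₀ os R, RRec F D g₀ os R → N18At R.u3`.  This file knits the seat's landed N18 theorems to THAT decl:
* §1 reading and transport: `n18At_mk_iff` (the decl on a bundle literal IS the K4 family shape `∀ b ∈ ]0,γ], NE5 EA (EB b) W κ θ C₅`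
  of `N18Knit` ∕ `N18End` ∕ `N18KingModel.ne5_family_of_const`), `n18At_of_ne5` (constant family), `n18At_mono` (window ∕ `γ` ∕
  `κ` ∕ `θ` ∕ `C₅` monotonicity — how pinned record letters are matched; `N18Knit.ne5_mono`), `n18At_letters_irrel` (the decl does
  not read `Λ, C₉, ω, cr, ρ`);
* §2 **`n18At_dressed_iff`** — on the DRESSED bundle of record (`Dom := Dom₀ ⊕ (Dom₀ × T)`, plan [YMPLAN-G61-WORD-U3-DRESSED], module 2's
  `U3Carriers` docstring): `N18At` ⇔ vacuum `N18At` ∧ `∀ t` dressed `N18At` at the SAME letters (`N18DressedCarriers.ne5_dressed_iff`);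
* §3 **`n18At_of_end8_shape`** — the END of row NE5 (`N18End.n18_family_of_end8`, T53) concludes EXACTLY `N18At` at the bundle
  `⟨torusCarriers N W, W′, γ, (1−10δ)½Lκ, g ↦ reFunctional N W (E₀ g) g, b g ↦ reFunctional N W (E₁ b g) g, θ, 2A₂C₃ε₁∕s, Λ, C₉, ω, cr, ρ⟩`
  for ANY remaining letters (the Bałaban-side knit: N18At under the END's binders — NODE O's per-term records, N10∕NODE A envelopes,
  rows NE2∕NE3's rate via `N18Knit.window_radius_le_reach`);
* §4 **`n18At_kingModel_threeFactor_torus`** — THE ROUTE'S N18 DECL INHABITED UNCONDITIONALLY by King's printed model: for King's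
  ACTUAL three-factor graphs (4.42) on Bałaban's tori (`N18KingModelTorus.ne5_kingModel_threeFactor_torus`, p418046) there are `κ > 0`,
  `C₅ ≥ 0` with `N18At ⟨C, W, γ′, κ, EA, fun _ => EB, L^{−γ∕2}, C₅, Λ, C₉, ω, cr, ρ⟩` for every carriers∕read-outs∕window∕letters
  — `θ = L^{−γ∕2} < 1` iff `γ > 0`;
* §5 the `S_N18` ONE-LINER'S SHAPE: `s_N18_of_u3_pinned` — any rate-record predicate that PINS the U3 bundle of `R` to bundles
  carrying `N18At` yields `S_N18 RRec`; `s_N18_toyRecord` — the stub for the TOY predicate «`R.u3` is King's model bundle» (a MODEL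
  record, NOT NODE 00's `RRec`), so the K4 join `SpineRates_of` consumes an inhabited `S_N18` at model level.
NOT COVERED: NODE 00's `RRec` (def-T, ETA 2026-08-30…09-01) and hence `S_N18 RRec` proper; NE5 for Bałaban's `E^{(j)}(X; g, U)`.

Sources: T. Bałaban, Commun. Math. Phys. **109** (1987) 249–301 [Balaban1987RG1] (0.24)–(0.25) p. 257, Thm 1 p. 259; **116**
(1988) 1–22 [Balaban1988RG2Cluster] (2.13)–(2.41) pp. 14–21 (the END's inputs); **119** (1988) 243–285 [Balaban1988Convergent]
(2.27) p. 259 (dressed pieces); C. King, Commun. Math. Phys. **102** (1986) 649–677 [King1986] Prop. 3.9 (3.73) p. 665.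
No claim about the mass gap.
-/

noncomputable section

namespace Summit.QuantumFields.YangMills.BalabanUVNodes.N18AtByName

open Matrix
open Literature.MathematicalPhysics.QuantumFieldTheory.Balaban1983to89
open Literature.MathematicalPhysics.QuantumFieldTheory.Balaban1983to89.T4Continuum
open Literature.MathematicalPhysics.QuantumFieldTheory.Balaban1983to89.T4OutputRate (Carriers Functional NE5)
open Literature.MathematicalPhysics.QuantumFieldTheory.Balaban1983to89.B5Prop11Plancherel (Tor fine)
open Literature.MathematicalPhysics.QuantumFieldTheory.Balaban1983to89.TreeLengthTorus (TDom)
open Literature.MathematicalPhysics.QuantumFieldTheory.Balaban1983to89.B13Lemma3Torus (TwoTorusStep)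
open Literature.MathematicalPhysics.QuantumFieldTheory.King1986 (aK)
open Literature.MathematicalPhysics.QuantumFieldTheory.King1986.Torus (minimiser effLaplacian blockProj blockOf tdistT)
open Summit.QuantumFields.BalabanUV.T4Continuum.Spine.NE5.TwoRunTorusNE5 (torusCarriers reFunctional)
open Summit.QuantumFields.YangMills.BalabanUVNodes.N18Knit (ne5_mono)
open Summit.QuantumFields.YangMills.BalabanUVNodes.N18DressedCarriers (ne5_dressed_iff)
open Summit.QuantumFields.YangMills.BalabanUVNodes.N18KingModelTorus (ne5_kingModel_threeFactor_torus)
open YMDAG.UVSplit (U3Carriers N18At S_N18 RateRecordPred RateCarriers Datum)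

/-! ## §1 Reading and transporting `N18At` -/

/-- **`N18At` on a bundle literal IS the K4 family shape** `∀ b ∈ ]0, γ], NE5 EA (EB b) W κ θ C₅` (`Iff.rfl`). [folklore] -/
theorem n18At_mk_iff {C : Carriers} {W : Set (ℕ → ℝ)} {γ κ : ℝ} {EA : Functional C C.BgA} {EB : ℝ → Functional C C.BgB}
    {θ C₅ : ℝ} {Λ : ℕ → ℕ → ℝ} {C₉ ω cr ρ : ℝ} :
    N18At ⟨C, W, γ, κ, EA, EB, θ, C₅, Λ, C₉, ω, cr, ρ⟩ ↔ ∀ b : ℝ, 0 < b → b ≤ γ → NE5 EA (EB b) W κ θ C₅ :=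
  Iff.rfl

/-- A single two-run rate `NE5 EA EB W κ θ C₅` gives `N18At` for the CONSTANT first-coupling family `fun _ => EB`, at any window
radius `γ` and any remaining letters. [folklore] -/
theorem n18At_of_ne5 {C : Carriers} {W : Set (ℕ → ℝ)} {κ θ C₅ : ℝ} {EA : Functional C C.BgA} {EB : Functional C C.BgB}
    (h : NE5 EA EB W κ θ C₅) (γ : ℝ) (Λ : ℕ → ℕ → ℝ) (C₉ ω cr ρ : ℝ) :
    N18At ⟨C, W, γ, κ, EA, fun _ => EB, θ, C₅, Λ, C₉, ω, cr, ρ⟩ :=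
  fun _ _ _ => h

/-- `N18At` does not read the NE9 ∕ read-out letters `Λ, C₉, ω, cr, ρ` of the shared bundle. [folklore] -/
theorem n18At_letters_irrel {C : Carriers} {W : Set (ℕ → ℝ)} {γ κ : ℝ} {EA : Functional C C.BgA}
    {EB : ℝ → Functional C C.BgB} {θ C₅ : ℝ} {Λ Λ' : ℕ → ℕ → ℝ} {C₉ C₉' ω ω' cr cr' ρ ρ' : ℝ}
    (h : N18At ⟨C, W, γ, κ, EA, EB, θ, C₅, Λ, C₉, ω, cr, ρ⟩) : N18At ⟨C, W, γ, κ, EA, EB, θ, C₅, Λ', C₉', ω', cr', ρ'⟩ :=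
  h

/-- **Letter matching** (how an END's letters meet a record's pinned letters): `N18At` survives shrinking the window and the
radius `γ`, lowering `κ`, raising `θ ≥ 0` and `C₅ ≥ 0` (`N18Knit.ne5_mono`). [folklore] -/
theorem n18At_mono {C : Carriers} {W W' : Set (ℕ → ℝ)} {γ γ' κ κ' : ℝ} {EA : Functional C C.BgA}
    {EB : ℝ → Functional C C.BgB} {θ θ' C₅ C₅' : ℝ} {Λ Λ' : ℕ → ℕ → ℝ} {C₉ C₉' ω ω' cr cr' ρ ρ' : ℝ}
    (h : N18At ⟨C, W, γ, κ, EA, EB, θ, C₅, Λ, C₉, ω, cr, ρ⟩) (hW : W' ⊆ W) (hγ : γ' ≤ γ) (hκ : κ' ≤ κ) (hθ : 0 ≤ θ)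
    (hθ' : θ ≤ θ') (hC₅ : 0 ≤ C₅) (hC : C₅ ≤ C₅') :
    N18At ⟨C, W', γ', κ', EA, EB, θ', C₅', Λ', C₉', ω', cr', ρ'⟩ :=
  fun b hb hbγ => ne5_mono (h b hb (hbγ.trans hγ)) hW hκ hθ hθ' hC₅ hC

/-! ## §2 `N18At` on the DRESSED bundle of record -/

/-- **N18's DECL ON THE DRESSED U3 BUNDLE = VACUUM `N18At` ∧ DRESSED `N18At` UNIFORMLY IN THE SOURCE, SAME LETTERS.**  With the
carriers of record `{ C with Dom := C.Dom ⊕ (C.Dom × T), scale (X,t) := scale X, d (X,t) := d X }` (module 2's `U3Carriers`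
docstring), run A reading `EA` ∕ `DA t`, run B's family reading `EB b` ∕ `DB t b`:
`N18At` (dressed bundle) ⇔ `N18At ⟨C, …, EA, EB, …⟩ ∧ ∀ t, N18At ⟨C, …, DA t, DB t, …⟩`. [cite: Balaban1988Convergent, (2.27) p.259] -/
theorem n18At_dressed_iff {C : Carriers} {T : Type} (EA : Functional C C.BgA) (EB : ℝ → Functional C C.BgB)
    (DA : T → Functional C C.BgA) (DB : T → ℝ → Functional C C.BgB) {W : Set (ℕ → ℝ)} {γ κ θ C₅ : ℝ}
    {Λ : ℕ → ℕ → ℝ} {C₉ ω cr ρ : ℝ} :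
    N18At ⟨{ C with
              Dom := C.Dom ⊕ (C.Dom × T)
              scale := Sum.elim C.scale fun p => C.scale p.1
              d := Sum.elim C.d fun p => C.d p.1
              d_nonneg := Sum.rec (fun X => C.d_nonneg X) fun p => C.d_nonneg p.1 },
            W, γ, κ, (fun g U X => Sum.elim (EA g U) (fun p => DA p.2 g U p.1) X),
            (fun b g U X => Sum.elim (EB b g U) (fun p => DB p.2 b g U p.1) X), θ, C₅, Λ, C₉, ω, cr, ρ⟩
      ↔ N18At ⟨C, W, γ, κ, EA, EB, θ, C₅, Λ, C₉, ω, cr, ρ⟩ ∧ ∀ t, N18At ⟨C, W, γ, κ, DA t, DB t, θ, C₅, Λ, C₉, ω, cr, ρ⟩ := by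
  constructor
  · intro h
    refine ⟨fun b hb hbγ => ?_, fun t b hb hbγ => ?_⟩
    · exact ((ne5_dressed_iff EA (EB b) DA (fun t => DB t b)).1 (h b hb hbγ)).1
    · exact ((ne5_dressed_iff EA (EB b) DA (fun t => DB t b)).1 (h b hb hbγ)).2 t
  · rintro ⟨h0, h1⟩ b hb hbγ
    exact (ne5_dressed_iff EA (EB b) DA (fun t => DB t b)).2 ⟨h0 b hb hbγ, fun t => h1 t b hb hbγ⟩

/-! ## §3 The END of row NE5 concludes `N18At` at the torus bundle (Bałaban side, under the END's binders) -/

/-- **THE END'S CONCLUSION IS `N18At`.**  The K4 family shape delivered by `N18End.n18_family_of_end8` (T53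
`TwoRunTorusNE5Final8.ne5_end_final_all8` re-indexed by member and coupling sequence) at the torus carriers
`torusCarriers N W`, the coupling-READING functionals `g ↦ reFunctional N W (E₀ g) g`, `b g ↦ reFunctional N W (E₁ b g) g`, window `W′`,
radius `γ`, letters `κ′, θ, C₅′` IS `N18At` at the bundle `⟨torusCarriers N W, W′, γ, κ′, …, θ, C₅′, Λ, C₉, ω, cr, ρ⟩` for any NE9 ∕
read-out letters — so N18 at those carriers holds under exactly the END's binders (NODE O's per-term records at the window
scales, N10 ∕ NODE A envelopes, rows NE2∕NE3's rate through `N18Knit.window_radius_le_reach`). [cite: Balaban1988RG2Cluster, (2.38)–(2.41) pp.20–21] -/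
theorem n18At_of_end8_shape {L : ℕ} [NeZero L] {N : ℕ → ℕ} [∀ j, NeZero (N j)] (W : (j : ℕ) → TwoTorusStep 4 L (N j))
    {E₀ : (g : ℕ → ℝ) → (j : ℕ) → TDom 4 (N j) → (W j).Φ → ℂ}
    {E₁ : (b : ℝ) → (g : ℕ → ℝ) → (j : ℕ) → TDom 4 (N j) → (W j).Φ → ℂ} {W' : Set (ℕ → ℝ)} {γ κ' θ C₅' : ℝ}
    (h : ∀ b : ℝ, 0 < b → b ≤ γ →
      NE5 (C := torusCarriers N W) (fun g => reFunctional N W (E₀ g) g) (fun g => reFunctional N W (E₁ b g) g)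
        W' κ' θ C₅')
    (Λ : ℕ → ℕ → ℝ) (C₉ ω cr ρ : ℝ) :
    N18At ⟨torusCarriers N W, W', γ, κ', fun g => reFunctional N W (E₀ g) g,
      fun b g => reFunctional N W (E₁ b g) g, θ, C₅', Λ, C₉, ω, cr, ρ⟩ :=
  h

/-! ## §4 THE ROUTE'S N18 DECL INHABITED by King's printed model (unconditional; `θ = L^{−γ∕2}`, `κ > 0`) -/

variable {d : ℕ}

/-- **`N18At` INHABITED WITH CONTENT.**  For `d ≥ 1`, odd `L > 1`, `a > 0`, `m² > 0`, `0 ≤ γ ≤ 1` there are `κ > 0`, `C₅ ≥ 0`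
(`d, L, a, m², γ` only) such that for every `n ≥ 1`, every family of Bałaban unit tori, every carriers `C` (`scale ≥ 1`, fine
points `x_A, y_A` under `x_B, y_B`, `d X ≤ |B(x_A) − B(y_A)|_{T₁}`), every functionals reading King's (4.42) three-factor graphs on
the scale-`j` tori, every window `W`, radius `γ′` and NE9 ∕ read-out letters:
`N18At ⟨C, W, γ′, κ, EA, fun _ => EB, L^{−γ∕2}, C₅, Λ, C₉, ω, cr, ρ⟩` — `N18KingModelTorus.ne5_kingModel_threeFactor_torus` ∘
`n18At_of_ne5`.  A = 0 MODEL, `g`∕`U` unread. [cite: King1986, Prop. 3.9 (3.73) p.665, (4.42)–(4.43) p.675] -/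
theorem n18At_kingModel_threeFactor_torus (hd : 1 ≤ d) (L : ℕ) [NeZero L] (hLp : Odd L ∧ 1 < L) {a m2 : ℝ}
    (ha : 0 < a) (hm : 0 < m2) {γ : ℝ} (hγ0 : 0 ≤ γ) (hγ1 : γ ≤ 1) :
    ∃ κ C₅ : ℝ, 0 < κ ∧ 0 ≤ C₅ ∧
      ∀ (n : ℕ) (_hn : 1 ≤ n) (M : ℕ → Fin d → ℕ) [∀ j μ, NeZero (M j μ)]
        (_hM : ∀ j, ∃ mm : ℕ, ∀ μ, L * M j μ = 2 * L ^ mm)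
        (C : Carriers) (_hsc : ∀ X, 1 ≤ C.scale X)
        (xA yA : (X : C.Dom) → Tor (fine (L ^ C.scale X) (fine L (M (C.scale X)))))
        (xB yB : (X : C.Dom) → Tor (fine (L ^ n * L ^ C.scale X) (fine L (M (C.scale X)))))
        (_hx : ∀ X μ, (xA X μ).val = (xB X μ).val / L ^ n)
        (_hy : ∀ X μ, (yA X μ).val = (yB X μ).val / L ^ n)
        (_hd : ∀ X, C.d X ≤ tdistT (fine L (M (C.scale X)))
            (blockOf (L ^ C.scale X) (fine L (M (C.scale X))) (xA X))
            (blockOf (L ^ C.scale X) (fine L (M (C.scale X))) (yA X)))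
        (EA : Functional C C.BgA) (EB : Functional C C.BgB)
        (_hEA : ∀ g U X, EA g U X =
          (fun z => minimiser (L ^ C.scale X) (fine L (M (C.scale X))) (aK a L (C.scale X))
              (((L ^ C.scale X : ℕ) : ℝ) ^ 2) m2 (Pi.single z 1) (xA X))
            ⬝ᵥ ((effLaplacian (L ^ C.scale X) (fine L (M (C.scale X))) (aK a L (C.scale X))
                    (((L ^ C.scale X : ℕ) : ℝ) ^ 2) m2
                  + (a * ((L : ℝ) ^ 2)⁻¹) • blockProj L (M (C.scale X)))⁻¹
                *ᵥ fun w => minimiser (L ^ C.scale X) (fine L (M (C.scale X))) (aK a L (C.scale X))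
                    (((L ^ C.scale X : ℕ) : ℝ) ^ 2) m2 (Pi.single w 1) (yA X)))
        (_hEB : ∀ g U X, EB g U X =
          (fun z => minimiser (L ^ n * L ^ C.scale X) (fine L (M (C.scale X))) (aK a L (C.scale X + n))
              (((L ^ n * L ^ C.scale X : ℕ) : ℝ) ^ 2) m2 (Pi.single z 1) (xB X))
            ⬝ᵥ ((effLaplacian (L ^ n * L ^ C.scale X) (fine L (M (C.scale X))) (aK a L (C.scale X + n))
                    (((L ^ n * L ^ C.scale X : ℕ) : ℝ) ^ 2) m2
                  + (a * ((L : ℝ) ^ 2)⁻¹) • blockProj L (M (C.scale X)))⁻¹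
                *ᵥ fun w => minimiser (L ^ n * L ^ C.scale X) (fine L (M (C.scale X))) (aK a L (C.scale X + n))
                    (((L ^ n * L ^ C.scale X : ℕ) : ℝ) ^ 2) m2 (Pi.single w 1) (yB X)))
        (W : Set (ℕ → ℝ)) (γ' : ℝ) (Λ : ℕ → ℕ → ℝ) (C₉ ω cr ρ : ℝ),
        N18At ⟨C, W, γ', κ, EA, fun _ => EB, (L : ℝ) ^ (-(γ / 2)), C₅, Λ, C₉, ω, cr, ρ⟩ := by
  obtain ⟨κ, C₅, hκ, hC₅, H⟩ := ne5_kingModel_threeFactor_torus hd L hLp ha hm hγ0 hγ1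
  refine ⟨κ, C₅, hκ, hC₅, ?_⟩
  intro n hn M _ hM C hsc xA yA xB yB hx hy hdd EA EB hEA hEB W γ' Λ C₉ ω cr ρ
  exact n18At_of_ne5 (H n hn M hM C hsc xA yA xB yB hx hy hdd EA EB hEA hEB W) γ' Λ C₉ ω cr ρ

/-! ## §5 The shape of the `S_N18 RRec` one-liner -/

/-- **THE `S_N18` ONE-LINER'S SHAPE.**  If a rate-record predicate `RRec` PINS the U3 bundle of every record `R` to a bundle
`u₀(F, D, g₀, os)` carrying `N18At`, then the K4 stub `S_N18 RRec` holds.  (NODE 00's `RRec` is not yet typed; when it sets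
`R.u3` from NODE O's objects, `h` is §3 ∕ `N18Coherence.ne5_family_couplingReading_of_primitive_rate` read at the record.) [folklore] -/
theorem s_N18_of_u3_pinned {Nc : ℕ} [NeZero Nc] (RRec : RateRecordPred Nc)
    (u₀ : (F : T4Family) → Datum F Nc → (ℕ → ℝ) → List (ULoop F) → U3Carriers)
    (h : ∀ F D g₀ os, N18At (u₀ F D g₀ os))
    (hpin : ∀ F D g₀ os (R : RateCarriers Nc), RRec F D g₀ os R → R.u3 = u₀ F D g₀ os) : S_N18 RRec := by
  intro F D g₀ os R hR
  rw [hpin F D g₀ os R hR]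
  exact h F D g₀ os

/-- **`S_N18` FOR A TOY RECORD PREDICATE (model level).**  For the predicate «the U3 bundle of `R` IS the bundle `u₀`» with any
`u₀` carrying `N18At` — e.g. King's model bundle of §4 — the K4 stub holds: `S_N18 (fun _ _ _ _ R => R.u3 = u₀)`.  A MODEL
record, NOT NODE 00's `RRec`; shows the join `SpineRates_of` can be fed an inhabited `S_N18`. [folklore] -/
theorem s_N18_toyRecord {Nc : ℕ} [NeZero Nc] (u₀ : U3Carriers) (h : N18At u₀) :
    S_N18 (N := Nc) (fun _ _ _ _ R => R.u3 = u₀) :=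
  s_N18_of_u3_pinned (Nc := Nc) _ (fun _ _ _ _ => u₀) (fun _ _ _ _ => h) (fun _ _ _ _ _ hR => hR)

end Summit.QuantumFields.YangMills.BalabanUVNodes.N18AtByName

end
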